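import Summits.BirchSwinnertonDyer.BirchSwinnertonDyer.Theorems.EisensteinPrimesBSDpOnCellCTelescopeK2CoreSpecification
import Summits.BirchSwinnertonDyer.BirchSwinnertonDyer.Theorems.EisensteinPrimesBSDpOnCellCTelescopeK2PurityTolerantOfCore
import Summits.BirchSwinnertonDyer.BirchSwinnertonDyer.Theorems.EisensteinPrimesBSDpOnCellCTelescopeK2CoreCRKTransfer
import Literature.NumberTheory.IwasawaTheory.Greenberg2016.NonPrimitiveSelmer
import Summits.BirchSwinnertonDyer.BirchSwinnertonDyer.Theorems.EisensteinPrimesGreenbergArchimedeanH1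
import Literature.NumberTheory.IwasawaTheory.Greenberg2016.SpecialisedLOC1
import Literature.NumberTheory.IwasawaTheory.IwasawaAlgebraTwoVar
import HarnessLib

/-!
# Crux 4 `BSDpOnCellC` (stmt-BirchSwinnertonDyer-19034), line «telescope», workfile `Lines/telescopeK2weight2.lean` v1.2,
# sub-leaf W4⁰ (`K2Weight2.stub_bigPseudoNullPTorsion`), route G′: **THE ASSEMBLY AT SELMER LEVEL** —
# every pseudo-null `B`-submodule of every Pontryagin dual of `S_𝓛(K, 𝐃)` is `p`-power torsion, FROM Greenberg's
# Prop. 4.1.1 (c) (named fact, hypothesis) applied to the CORE specification `𝓛'`, and the displayed rows for `𝓛`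
# (ideator seat `bsd-idea-12` gen 39; `--supports stmt-BirchSwinnertonDyer-19034 --as helper`; THEOREMS ONLY; closes nothing)

HONEST FRAMING. No registered stub, no crux, no summit statement is proved here; BSD is proved for no curve. This file
is the kernel-checked form of route G′ of the memo `Cruxes/BSDpOnCellC/W-PRICING-n2.md` (rev 1.10 §W4-G′): for the
descended big representation `ρ_S` of `𝐃 = AnticyclotomicBigGaloisRep κ ρ` (`B = ℤ_p⟦X⟧⟦T⟧`-module
`BigRepModule 𝒪 p A`) and the K2 strict structure `𝓛 = specOfIndexSet S ρ_S (strictSet p 𝔮 Σ₀)`,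

  W4⁰ at Selmer level: `∀ X` dual to `S_𝓛(K, 𝐃)`, `∀ P ≤ X` pseudo-null, `∃ m, p^m · P = 0`

follows from
* the NAMED FACT `prop411_selmer_isAlmostDivisible` (Greenberg 2016 Prop. 4.1.1, hypothesis `h411`; a published
  theorem typed as a `Prop`, never proved here) applied to the CORE `𝓛'` of `…TelescopeK2CoreSpecification`
  (`𝓛' ≤ 𝓛`, `p^a 𝓛 ⊆ 𝓛'`, `𝓛'` almost divisible, `𝓛'_𝔭 = 𝓛_𝔭 = H¹(K_𝔭, 𝐃)`, `𝓛'` by `R`-submodules), in case (c)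
  at `η = 𝔭` (`Q_{𝓛'}(K_𝔭, 𝐃) = 0` is coreflexive);
* the CRK transfer `CRK(𝐃, 𝓛) ⇒ CRK(𝐃, 𝓛')` (`…TelescopeK2CoreCRKTransfer.crk_of_core_pow`, `(p : B) ≠ 0`);
* the tolerance of every dual of `S_𝓛` from the almost divisible core
  (`…TelescopeK2PurityTolerantOfCore.forall_isPseudoNull_exists_pow_smul_eq_zero_selmer_of_core`);
* §1, PROVED here: restriction in Galois cohomology commutes with the maps induced in the coefficients
  (`Hpullback_Hmap`, `Hpullback_localScalar`), whence the former row (G9) «`𝓛` is by `R`-submodules» holds for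
  EVERY `R` (`specOfIndexSet_isStable`: `⊤`, `⊥`, `ker(H¹(K_w, 𝐃) → H¹(I_w, 𝐃))` are `R`-stable);
* the tree's `B = ℤ_p⟦X⟧⟦T⟧ ≃+* ℤ_p⟦T₁, T₂⟧` (`nonempty_iwasawaAlgebraTwoVar_ringEquiv_mvPowerSeries`, the former
  row (G1), `m = 2`);
* the former row (G10): `H¹(K_w, 𝐃)` is almost divisible at every finite `w ∈ S ∖ {𝔮}` carrying no inertia index, from
  RFX(𝐃) + LOC_w⁽¹⁾ (Greenberg 2016 Prop. 4.2.2 with `H²(K_w, 𝐃) = 0` from [Gr4] §5 A — the tree THEOREM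
  `Greenberg2016.isAlmostDivisible_localRep_H_one`), and `H¹(K_v, 𝐃) = 0` at the archimedean places of a field all of
  whose infinite places are complex (`hTC`; `GreenbergFullAtSelmer.subsingleton_localH1_inl_of_isComplex`);

GRANTED, as displayed hypotheses (the Greenberg-side bench rows of the memo's table, all for `𝓛` / `𝐃`, none of them
about the core): (G2) the bigger coefficient ring `R ⊇ B` of Prop. 4.1.1's standing setting
with `ρ_S` `R`-linear (`hR`); (G3) `𝐃` cofree over `R` and RFX(𝐃); (G4) LEO(𝐃); (G5) LOC⁽¹⁾ at every finite
`w ∈ S ∖ {𝔮}` carrying no inertia index (`w ∣ p` or `w ∈ Σ₀`; in the cell, `K` imaginary quadratic with `p = 𝔭𝔭̄`,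
`𝔮 = 𝔭̄`, `Σ₀ = ∅`: ONLY `w = 𝔭`), one of which is `𝔭 ∣ p`, `𝔭 ≠ 𝔮`; (G7) LOC⁽²⁾ on `Σ`; (G8) CRK(𝐃, 𝓛); `hTC`: every
infinite place of `K` is complex; and `S` finite containing the primes above `p`, `ramificationSubgroup K S ≤ ker 𝐃`,
`𝐃` cofinitely generated over `B` (= W1, discharged in the tree for the cell). The `p`-primarity of `𝐃` is FREE
(`BigRepModule` is `p`-power torsion by construction). No `def`, no `instance`, no named fact introduced, no `sorry`. AI-typed,
kernel-checked.

References: R. Greenberg, On the structure of Selmer groups (2016), Prop. 4.1.1 (c), Prop. 4.2.2, §2.5 p. 8 L35–37,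
Remark 3.1.2, §4.2 p. 19 L25–31 [Greenberg2016Selmer]; R. Greenberg, Doc. Math. Extra Vol. Coates (2006), Prop. 2.4,
§2 A, §5 A [Greenberg2006]; F. Castella, Camb. J. Math. 6 (2018) §2.1 and erratum §2 [Castella2018, Castella2018Erratum];
C. Skinner, E. Urban, Invent. math. 195 (2014) Prop. 3.2.3 [SkinnerUrban2014].
-/

set_option linter.dupNamespace false
set_option autoImplicit false

noncomputable section

open Function
open Field IsDedekindDomain NumberField
open Literature.NumberTheory.GaloisRepresentations Literature.NumberTheory.EllipticCurves
open Literature.NumberTheory.EllipticCurves.BigGaloisRep Literature.NumberTheory.IwasawaTheory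
open scoped NumberField

universe u

namespace Summit.BirchSwinnertonDyer.BirchSwinnertonDyer.Theorems.TelescopeK2PurityOfProp411

/-! ## §1. Naturality of restriction in the coefficients; row (G9) is free -/

section Naturality

variable {Λ : Type u} [CommRing Λ] [TopologicalSpace Λ]
  {G : Type u} [Group G] [TopologicalSpace G] [IsTopologicalGroup G]
  {H : Type u} [Group H] [TopologicalSpace H] [IsTopologicalGroup H]
  {M : Type u} [AddCommGroup M] [Module Λ M] [TopologicalSpace M] [IsTopologicalAddGroup M]
  [ContinuousSMul Λ M]
  {N : Type u} [AddCommGroup N] [Module Λ N] [TopologicalSpace N] [IsTopologicalAddGroup N]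
  [ContinuousSMul Λ N]

open CategoryTheory in
/-- **Restriction along `ι : H → G` commutes with the map induced by an equivariant `f : M → N` in the
coefficients**: `res_ι ∘ H^q(f) = H^q(f) ∘ res_ι` (both are `ContinuousCohomology.map` along `ι` with `f`;
`ContinuousCohomology.map_comp`). [cite: NeukirchSchmidtWingberg2008, (1.5.2) (functoriality of `Hⁿ` in the pair)] -/
theorem Hpullback_Hmap (τ : ContinuousRep G Λ M) (τ' : ContinuousRep G Λ N) (f : M →L[Λ] N)
    (hf : ∀ (g : G) (m : M), f (τ g m) = τ' g (f m)) (ι : H →ₜ* G) (q : ℕ) (x : τ.H q) :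
    τ'.Hpullback ι q (Greenberg2016.Hmap τ τ' f hf q x) =
      Greenberg2016.Hmap (τ.restrict ι) (τ'.restrict ι) f (fun h m => hf (ι h) m) q (τ.Hpullback ι q x) := by
  change (ContinuousCohomology.map (ContinuousMonoidHom.id G) _ q ≫ ContinuousCohomology.map ι _ q).hom x =
    (ContinuousCohomology.map ι _ q ≫ ContinuousCohomology.map (ContinuousMonoidHom.id H) _ q).hom x
  rw [← ContinuousCohomology.map_comp, ← ContinuousCohomology.map_comp]
  rfl

end Naturality

section Stable

variable {K : Type u} [Field K] [NumberField K] (S : Set (HeightOneSpectrum (𝓞 K)))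
  {Λ : Type u} [CommRing Λ] [TopologicalSpace Λ]
  {D : Type u} [AddCommGroup D] [Module Λ D] [TopologicalSpace D] [DiscreteTopology D] [ContinuousSMul Λ D]
  (ρ : ContinuousRep (GaloisGroupUnramifiedOutside K S) Λ D)

/-- The `R`-scalars of `Hⁿ(K_v, 𝐃)` (`localScalar`) commute with restriction to any `ι : H → Γ_{K_v}`
(e.g. the inertia group). [cite: Greenberg2016Selmer, §1 p. 3 L15–21] -/
theorem Hpullback_localScalar (v : Place K) {R : Type u} [CommRing R] [Module R D] [SMulCommClass R Λ D]
    (r : R) (hr : ∀ (g : GaloisGroupUnramifiedOutside K S) (d : D), ρ g (r • d) = r • ρ g d)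
    {H : Type u} [Group H] [TopologicalSpace H] [IsTopologicalGroup H]
    (ι : H →ₜ* absoluteGaloisGroup v.Completion) (q : ℕ) (x : (Greenberg2016.localRep S ρ v).H q) :
    (Greenberg2016.localRep S ρ v).Hpullback ι q (Greenberg2016.localScalar S ρ v r hr q x) =
      Greenberg2016.Hmap ((Greenberg2016.localRep S ρ v).restrict ι) ((Greenberg2016.localRep S ρ v).restrict ι)
        ⟨DistribSMul.toLinearMap Λ D r, continuous_of_discreteTopology⟩
        (fun h d => (hr (Greenberg2016.localToUnramified S v (ι h)) d).symm) q
        ((Greenberg2016.localRep S ρ v).Hpullback ι q x) :=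
  Hpullback_Hmap _ _ _ _ ι q x

/-- **Row (G9) is free: the specification `𝓛(L₀)` matching ANY K2 index set is by `R`-submodules for EVERY
bigger coefficient ring `R`** (`⊤`, `⊥` and `ker(H¹(K_w, 𝐃) → H¹(I_w, 𝐃))` are stable under the `R`-scalars,
the last by `Hpullback_localScalar`). [cite: Greenberg2016Selmer, §1 p. 3 L19–21] [cite: Castella2018Erratum, §2] -/
theorem specOfIndexSet_isStable {R : Type u} [CommRing R] [Module R D] [SMulCommClass R Λ D]
    (hR : ∀ (g : GaloisGroupUnramifiedOutside K S) (r : R) (d : D), ρ g (r • d) = r • ρ g d)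
    (L₀ : Set (BigGaloisRep.LocalIndex K)) :
    (TelescopeK2SelmerDictionary.specOfIndexSet S ρ L₀).IsStable hR := by
  rintro (v | w) _ r c hc
  · rw [TelescopeK2SelmerDictionary.specOfIndexSet_inl]
    exact Submodule.mem_top
  · rw [TelescopeK2SelmerDictionary.mem_specOfIndexSet_inr_iff] at hc ⊢
    refine ⟨fun h => ?_, fun h => ?_⟩
    · rw [hc.1 h, map_zero]
    · rw [Hpullback_localScalar, hc.2 h, map_zero]

end Stable

/-! ## §2. The assembly -/

section Main

variable {K : Type} [Field K] [NumberField K] (p : ℕ) [Fact p.Prime]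
  {A : Type} [AddCommGroup A] [Module (IwasawaAlgebra p) A] [TopologicalSpace A] [DiscreteTopology A]
  [TopologicalSpace (IwasawaAlgebra p)] [TopologicalSpace (IwasawaAlgebra₂ p)]
  [IsTopologicalRing (IwasawaAlgebra₂ p)]
  [ContinuousSMul (IwasawaAlgebra₂ p) (BigRepModule (IwasawaAlgebra p) p A)]

/-- **Route G′, assembled at Selmer level (W4⁰ from Prop. 4.1.1 (c) at the core `𝓛'`).** Notation:
`B = IwasawaAlgebra₂ p`, `𝐃 = BigRepModule (IwasawaAlgebra p) p A` with the action `AnticyclotomicBigGaloisRep κ ρ`,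
`ρ_S = descendUnramified S 𝐃 hS`, `𝓛 = specOfIndexSet S ρ_S (strictSet p 𝔮 Σ₀)`. GRANTED Greenberg 2016 Prop. 4.1.1
(`h411`, named fact), the displayed rows (G2)–(G8) listed in the module docstring and `hTC`, every pseudo-null `B`-submodule
of every Pontryagin dual `X` of `S_𝓛(K, 𝐃)` is killed by a power of `p`. Proof: the core `𝓛'`
(`exists_core_specification_strictSet`) is almost divisible, by `R`-submodules (`isStable_of_core` ∘ `specOfIndexSet_isStable`), has
`CRK(𝐃, 𝓛')` (`crk_of_core_pow`) and `Q_{𝓛'}(K_𝔭) = 0` coreflexive, so Prop. 4.1.1 (c) at `η = 𝔭` makes `S_{𝓛'}`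
almost divisible, and part 1 (`forall_isPseudoNull_exists_pow_smul_eq_zero_selmer_of_core`) transfers along
`p^a S_𝓛 ≤ S_{𝓛'} ≤ S_𝓛`. [cite: Greenberg2016Selmer, Prop. 4.1.1 (c), §2.5 p. 8 L35–37, Remark 3.1.2, §4.2 p. 19 L25–31]
[cite: Greenberg2006, Prop. 2.4, §2 A] [cite: Castella2018Erratum, §2] -/
theorem forall_isPseudoNull_exists_pow_smul_eq_zero_of_prop411
    (h411 : Greenberg2016.prop411_selmer_isAlmostDivisible)
    (κ : ZpExtension K p) (ρ : ContinuousRep (absoluteGaloisGroup K) (IwasawaAlgebra p) A)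
    (hD : Greenberg2006.IsCofinitelyGenerated (IwasawaAlgebra₂ p) (BigRepModule (IwasawaAlgebra p) p A))
    (S : Set (HeightOneSpectrum (𝓞 K))) (hSf : S.Finite)
    (hSp : ∀ v : HeightOneSpectrum (𝓞 K), ((p : ℕ) : 𝓞 K) ∈ v.asIdeal → v ∈ S)
    (hS : ramificationSubgroup K S ≤ (AnticyclotomicBigGaloisRep κ ρ).ker)
    (𝔮 : HeightOneSpectrum (𝓞 K)) (Sig : Set (HeightOneSpectrum (𝓞 K)))
    (R : Type) [CommRing R] [IsLocalRing R] [IsNoetherianRing R] [Algebra (IwasawaAlgebra₂ p) R]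
    (hRinj : Function.Injective (algebraMap (IwasawaAlgebra₂ p) R)) (hRfin : Module.Finite (IwasawaAlgebra₂ p) R)
    (hRcpl : IsAdicComplete (IsLocalRing.maximalIdeal R) R) (hRres : Finite (IsLocalRing.ResidueField R))
    (hRchar : CharP (IsLocalRing.ResidueField R) p)
    [Module R (BigRepModule (IwasawaAlgebra p) p A)]
    [IsScalarTower (IwasawaAlgebra₂ p) R (BigRepModule (IwasawaAlgebra p) p A)]
    [SMulCommClass R (IwasawaAlgebra₂ p) (BigRepModule (IwasawaAlgebra p) p A)]
    (hR : ∀ (g : GaloisGroupUnramifiedOutside K S) (r : R) (d : BigRepModule (IwasawaAlgebra p) p A),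
      TelescopeK2RepDescent.descendUnramified S (AnticyclotomicBigGaloisRep κ ρ) hS g (r • d) =
        r • TelescopeK2RepDescent.descendUnramified S (AnticyclotomicBigGaloisRep κ ρ) hS g d)
    (hcofree : Greenberg2016.IsCofree R (BigRepModule (IwasawaAlgebra p) p A))
    (hRFX : Greenberg2016.RFX (IwasawaAlgebra₂ p) (BigRepModule (IwasawaAlgebra p) p A))
    (hLEO : Greenberg2016.LEO S (TelescopeK2RepDescent.descendUnramified S (AnticyclotomicBigGaloisRep κ ρ) hS))
    (hLOC2 : ∀ v : Place K, Greenberg2016.InSigma S v →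
      Greenberg2016.LOC2 S (TelescopeK2RepDescent.descendUnramified S (AnticyclotomicBigGaloisRep κ ρ) hS) v)
    (𝔭 : HeightOneSpectrum (𝓞 K)) (h𝔭S : 𝔭 ∈ S) (h𝔭p : ((p : ℕ) : 𝓞 K) ∈ 𝔭.asIdeal) (h𝔭q : 𝔭 ≠ 𝔮)
    (hLOC1 : ∀ w ∈ S, w ≠ 𝔮 → (((p : ℕ) : 𝓞 K) ∈ w.asIdeal ∨ w ∈ Sig) →
      Greenberg2016.LOC1 S (TelescopeK2RepDescent.descendUnramified S (AnticyclotomicBigGaloisRep κ ρ) hS) (Sum.inr w))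
    (hCRK : (TelescopeK2SelmerDictionary.specOfIndexSet S
      (TelescopeK2RepDescent.descendUnramified S (AnticyclotomicBigGaloisRep κ ρ) hS) (strictSet p 𝔮 Sig)).CRK)
    (hTC : ∀ v : InfinitePlace K, v.IsComplex)
    {X : Type} [AddCommGroup X] [Module (IwasawaAlgebra₂ p) X]
    {toDual : X →+ (↥(TelescopeK2SelmerDictionary.specOfIndexSet S
      (TelescopeK2RepDescent.descendUnramified S (AnticyclotomicBigGaloisRep κ ρ) hS) (strictSet p 𝔮 Sig)).selmer →+
        AddCircle (1 : ℚ))}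
    (hX : Greenberg2016.IsDualPairing (IwasawaAlgebra₂ p) ↥(TelescopeK2SelmerDictionary.specOfIndexSet S
      (TelescopeK2RepDescent.descendUnramified S (AnticyclotomicBigGaloisRep κ ρ) hS) (strictSet p 𝔮 Sig)).selmer
        toDual) :
    ∀ P : Submodule (IwasawaAlgebra₂ p) X, Module.IsPseudoNull (IwasawaAlgebra₂ p) ↥P →
      ∃ n : ℕ, ∀ x ∈ P, (((p : ℕ) : IwasawaAlgebra₂ p) ^ n) • x = 0 := by
  -- `p ≠ 0` in `B = ℤ_p⟦X⟧⟦T⟧` (read off the constant term), and `𝐃` is `p`-primary (free for `BigRepModule`).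
  have hp0 : ((p : ℕ) : IwasawaAlgebra₂ p) ≠ 0 := fun h => by
    have h' := congrArg (fun f : IwasawaAlgebra₂ p => PowerSeries.constantCoeff (PowerSeries.constantCoeff f)) h
    simp only [map_natCast, map_zero, Nat.cast_eq_zero] at h'
    exact (Fact.out : p.Prime).ne_zero h'
  have hprim : ∀ d : BigRepModule (IwasawaAlgebra p) p A, ∃ n : ℕ, (p ^ n : ℤ) • d = 0 := fun d => by
    obtain ⟨k, hk⟩ := BigRepModule.exists_pow_nsmul_eq_zero d
    exact ⟨k, by rw [← Nat.cast_pow, natCast_zsmul]; exact hk⟩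
  -- LOC⁽¹⁾ at `𝔭`; `H¹(K_v, 𝐃) = 0` at the (complex) archimedean places; `H¹(K_w, 𝐃)` almost divisible at the
  -- no-index places from RFX + LOC_w⁽¹⁾ ([Gr5] Prop. 4.2.2 / [Gr4] §5 A: tree theorem `isAlmostDivisible_localRep_H_one`).
  have hLOC1𝔭 : Greenberg2016.LOC1 S (TelescopeK2RepDescent.descendUnramified S (AnticyclotomicBigGaloisRep κ ρ) hS)
      (Sum.inr 𝔭) := hLOC1 𝔭 h𝔭S h𝔭q (Or.inl h𝔭p)
  have harch : ∀ v : InfinitePlace K, Subsingleton ((Greenberg2016.localRep S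
      (TelescopeK2RepDescent.descendUnramified S (AnticyclotomicBigGaloisRep κ ρ) hS) (Sum.inl v)).H 1) := fun v =>
    GreenbergFullAtSelmer.subsingleton_localH1_inl_of_isComplex S _ (hTC v)
  have hfin : ∀ w ∈ S, w ≠ 𝔮 → (((p : ℕ) : 𝓞 K) ∈ w.asIdeal ∨ w ∈ Sig) →
      Greenberg2016.IsAlmostDivisible (IwasawaAlgebra₂ p)
        ↥(⊤ : Submodule (IwasawaAlgebra₂ p) ((Greenberg2016.localRep S
          (TelescopeK2RepDescent.descendUnramified S (AnticyclotomicBigGaloisRep κ ρ) hS) (Sum.inr w)).H 1)) :=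
    fun w hwS hwq hw =>
      (Greenberg2016.isAlmostDivisible_localRep_H_one S
          (TelescopeK2RepDescent.descendUnramified S (AnticyclotomicBigGaloisRep κ ρ) hS) hSf hSp
          (Classical.choice (nonempty_iwasawaAlgebraTwoVar_ringEquiv_mvPowerSeries p)) hprim hD hRFX
          (hLOC1 w hwS hwq hw)).of_surjective
        (Submodule.topEquiv :
            ↥(⊤ : Submodule (IwasawaAlgebra₂ p) ((Greenberg2016.localRep S
              (TelescopeK2RepDescent.descendUnramified S (AnticyclotomicBigGaloisRep κ ρ) hS) (Sum.inr w)).H 1)) ≃ₗ[_]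
              _).symm.toLinearMap
        Submodule.topEquiv.symm.surjective
  obtain ⟨L', a, hle, hr, hshape, hoff, hL'⟩ :=
    TelescopeK2CoreSpecification.exists_core_specification_strictSet p κ ρ hD S hSf hS 𝔮 Sig hfin harch
  have hCRK' : L'.CRK := TelescopeK2CoreCRKTransfer.crk_of_core_pow hle hp0 a hr hCRK
  have hSt' : L'.IsStable hR :=
    TelescopeK2CoreSpecification.isStable_of_core hR _ hshape (specOfIndexSet_isStable S _ hR _)
  have htop : L' (Sum.inr 𝔭) = ⊤ :=
    (hoff 𝔭 (Or.inl h𝔭p)).trans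
      (TelescopeK2CoreSpecification.specOfIndexSet_strictSet_inr_of_noIndex S _ p 𝔮 Sig h𝔭q (Or.inl h𝔭p))
  have hcorefl : Greenberg2016.IsCoreflexive (IwasawaAlgebra₂ p) (L'.Q (Sum.inr 𝔭)) := by
    haveI : Subsingleton (L'.Q (Sum.inr 𝔭)) := Submodule.Quotient.subsingleton_iff.mpr htop
    exact Greenberg2016.isCoreflexive_of_subsingleton
  have hS' : Greenberg2016.IsAlmostDivisible (IwasawaAlgebra₂ p) ↥L'.selmer :=
    h411 p K S hSf hSp (IwasawaAlgebra₂ p) 2 (nonempty_iwasawaAlgebraTwoVar_ringEquiv_mvPowerSeries p) R hRinj hRfin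
      hRcpl hRres hRchar
      (BigRepModule (IwasawaAlgebra p) p A)
      (TelescopeK2RepDescent.descendUnramified S (AnticyclotomicBigGaloisRep κ ρ) hS) hR hcofree hprim L' hSt'
      hRFX hLEO hLOC2 ⟨𝔭, h𝔭S, hLOC1𝔭⟩ hL' hCRK'
      (Or.inr (Or.inr ⟨𝔭, h𝔭S, hLOC1𝔭, hcorefl⟩))
  exact TelescopeK2PurityTolerantOfCore.forall_isPseudoNull_exists_pow_smul_eq_zero_selmer_of_core hle _ a hr hS' hX

/-- **Route G′ at `X₂ = X^Σ_ac = Sel^Σ_𝔮(K, 𝐃)^∨` (the W4⁰ conclusion shape).** With `𝔮 ∈ S` and `S ⊇ Σ₀ ∪ {w ∣ p}`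
(`hSig`), the K2 Selmer group `selmerBig κ ρ 𝔮 Σ₀` IS `S_𝓛(K, 𝐃)` along inflation (`selmerEquivOfKer`, the dictionary
G1), so its Pontryagin dual `XBig κ ρ 𝔮 Σ₀` is a dual of `S_𝓛` (`isDualPairing_precomp_linearEquiv`,
`isDualPairing_characterModule`) and the Selmer-level assembly applies: GRANTED Prop. 4.1.1, the rows (G2)–(G8) and `hTC`,
every pseudo-null `B`-submodule of `XBig κ ρ 𝔮 Σ₀` is killed by a power of `p`.
[cite: Greenberg2016Selmer, Prop. 4.1.1 (c), §1 p. 3 L22–34, Remark 3.1.2] [cite: Castella2018Erratum, §2]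
[cite: Greenberg2006, Prop. 2.4, §2 A] -/
theorem forall_isPseudoNull_XBig_exists_pow_smul_eq_zero_of_prop411
    (h411 : Greenberg2016.prop411_selmer_isAlmostDivisible)
    (κ : ZpExtension K p) (ρ : ContinuousRep (absoluteGaloisGroup K) (IwasawaAlgebra p) A)
    (hD : Greenberg2006.IsCofinitelyGenerated (IwasawaAlgebra₂ p) (BigRepModule (IwasawaAlgebra p) p A))
    (S : Set (HeightOneSpectrum (𝓞 K))) (hSf : S.Finite)
    (hSp : ∀ v : HeightOneSpectrum (𝓞 K), ((p : ℕ) : 𝓞 K) ∈ v.asIdeal → v ∈ S)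
    (hS : ramificationSubgroup K S ≤ (AnticyclotomicBigGaloisRep κ ρ).ker)
    (𝔮 : HeightOneSpectrum (𝓞 K)) (h𝔮S : 𝔮 ∈ S) (Sig : Set (HeightOneSpectrum (𝓞 K)))
    (hSig : ∀ w : HeightOneSpectrum (𝓞 K), w ∉ S → w ∉ Sig ∧ ((p : ℕ) : 𝓞 K) ∉ w.asIdeal)
    (R : Type) [CommRing R] [IsLocalRing R] [IsNoetherianRing R] [Algebra (IwasawaAlgebra₂ p) R]
    (hRinj : Function.Injective (algebraMap (IwasawaAlgebra₂ p) R)) (hRfin : Module.Finite (IwasawaAlgebra₂ p) R)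
    (hRcpl : IsAdicComplete (IsLocalRing.maximalIdeal R) R) (hRres : Finite (IsLocalRing.ResidueField R))
    (hRchar : CharP (IsLocalRing.ResidueField R) p)
    [Module R (BigRepModule (IwasawaAlgebra p) p A)]
    [IsScalarTower (IwasawaAlgebra₂ p) R (BigRepModule (IwasawaAlgebra p) p A)]
    [SMulCommClass R (IwasawaAlgebra₂ p) (BigRepModule (IwasawaAlgebra p) p A)]
    (hR : ∀ (g : GaloisGroupUnramifiedOutside K S) (r : R) (d : BigRepModule (IwasawaAlgebra p) p A),
      TelescopeK2RepDescent.descendUnramified S (AnticyclotomicBigGaloisRep κ ρ) hS g (r • d) =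
        r • TelescopeK2RepDescent.descendUnramified S (AnticyclotomicBigGaloisRep κ ρ) hS g d)
    (hcofree : Greenberg2016.IsCofree R (BigRepModule (IwasawaAlgebra p) p A))
    (hRFX : Greenberg2016.RFX (IwasawaAlgebra₂ p) (BigRepModule (IwasawaAlgebra p) p A))
    (hLEO : Greenberg2016.LEO S (TelescopeK2RepDescent.descendUnramified S (AnticyclotomicBigGaloisRep κ ρ) hS))
    (hLOC2 : ∀ v : Place K, Greenberg2016.InSigma S v →
      Greenberg2016.LOC2 S (TelescopeK2RepDescent.descendUnramified S (AnticyclotomicBigGaloisRep κ ρ) hS) v)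
    (𝔭 : HeightOneSpectrum (𝓞 K)) (h𝔭S : 𝔭 ∈ S) (h𝔭p : ((p : ℕ) : 𝓞 K) ∈ 𝔭.asIdeal) (h𝔭q : 𝔭 ≠ 𝔮)
    (hLOC1 : ∀ w ∈ S, w ≠ 𝔮 → (((p : ℕ) : 𝓞 K) ∈ w.asIdeal ∨ w ∈ Sig) →
      Greenberg2016.LOC1 S (TelescopeK2RepDescent.descendUnramified S (AnticyclotomicBigGaloisRep κ ρ) hS) (Sum.inr w))
    (hCRK : (TelescopeK2SelmerDictionary.specOfIndexSet S
      (TelescopeK2RepDescent.descendUnramified S (AnticyclotomicBigGaloisRep κ ρ) hS) (strictSet p 𝔮 Sig)).CRK)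
    (hTC : ∀ v : InfinitePlace K, v.IsComplex) :
    ∀ P : Submodule (IwasawaAlgebra₂ p) (XBig κ ρ 𝔮 Sig), Module.IsPseudoNull (IwasawaAlgebra₂ p) ↥P →
      ∃ n : ℕ, ∀ x ∈ P, (((p : ℕ) : IwasawaAlgebra₂ p) ^ n) • x = 0 := by
  obtain ⟨hL, hoff⟩ := TelescopeK2SelmerDictionary.strictSet_hyps S p 𝔮 Sig h𝔮S hSig
  have hX := Greenberg2016.isDualPairing_precomp_linearEquiv
    (TelescopeK2SelmerDictionary.selmerEquivOfKer S (AnticyclotomicBigGaloisRep κ ρ) hS (strictSet p 𝔮 Sig) hL hoff :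
      _ ≃ₗ[IwasawaAlgebra₂ p] ↥(selmerBig κ ρ 𝔮 Sig))
    (Greenberg2016.isDualPairing_characterModule (IwasawaAlgebra₂ p) ↥(selmerBig κ ρ 𝔮 Sig))
  exact forall_isPseudoNull_exists_pow_smul_eq_zero_of_prop411 p h411 κ ρ hD S hSf hSp hS 𝔮 Sig R hRinj hRfin hRcpl
    hRres hRchar hR hcofree hRFX hLEO hLOC2 𝔭 h𝔭S h𝔭p h𝔭q hLOC1 hCRK hTC hX

end Main

end Summit.BirchSwinnertonDyer.BirchSwinnertonDyer.Theorems.TelescopeK2PurityOfProp411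

end
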